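import Summits.NavierStokesRegularity.NavierStokesRegularity.Theorems.EulerZoomLiouvillePowerGaugeEulerLiouvilleSelfSimilarProfileEquation
import Summits.NavierStokesRegularity.NavierStokesRegularity.Theorems.EulerZoomLiouvillePowerGaugeEulerLiouvilleProfileEnergyEquality
import Summits.NavierStokesRegularity.NavierStokesRegularity.Theorems.EulerZoomLiouvillePowerGaugeEulerLiouvilleSelfSimilarGauges
import Summits.NavierStokesRegularity.NavierStokesRegularity.Theorems.EulerZoomLiouvillePowerGaugeEulerLiouvilleSelfSimilarGradient
import Summits.NavierStokesRegularity.NavierStokesRegularity.Theorems.EulerZoomLiouvillePowerGaugeEulerLiouvilleSelfSimilarPressure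
import Literature.Analysis.FluidPDE.CKNVelocityIntegrability
import HarnessLib

/-!
# The profile local energy EQUALITY of exactly self-similar members of the power-gauged class
# (crux `EulerZoomLiouville.PowerGaugeEulerLiouville` = stmt-NavierStokesRegularity-19832, line `birth`, rung C1)

Route `EulerZoomLiouville` (NavierStokesRegularity).  COMPOSITION: the crux's hypotheses VERBATIM (suitable weak
ancient Euler pair on the slab with weak gradient `H` and the three power gauges, exponent `0 < ρ < 1`) plus exact
self-similarity (`u(τ) = selfSimilarCollapse γ 0 V τ`, `p(τ) = selfSimilarCollapsePressure γ 0 P τ`,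
`γ = 1/(2+ρ)`) give, for every `σ ∈ C_c^∞(ℝ³)`, the PROFILE LOCAL ENERGY EQUALITY

  `(2 − 5γ) ∫ σ|V|² = ∫ (|V|² + 2P)⟪V, ∇σ⟫ + γ ∫ |V|²⟪y, ∇σ⟫`

(`selfSimilar_profile_local_energy_equality`).  Ingredients, all kernel-checked: the lineage's dictionary
(`exists_profileGradient_ae`, `profile_energy_growth_of_gaugeA`, `profile_gradient_weight_of_gaugeE`,
`profile_pressure_weight_of_gaugeD`), the local Sobolev embedding `H¹(B) ⊂ L⁶(B)` (`exists_eLpNorm_six_le_ball`),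
the weak profile equation and divergence-freeness transferred from the member's Euler identity
(`ProfileEquation.weak_profile_equation`, `ProfileEquation.profile_isWeaklyDivFree`), and the velocity-testing
theorem `ProfileEnergy.profile_local_energy_equality`.  This is the EQUALITY case of the one-sided profile LEI
`selfSimilar_profile_energy_le_add_flux` — the first in-window statement on rung C1 that uses the Euler momentum
identity and not only the local energy inequality (critic-2 K3).  At `ρ < 1/2` (`γ > 2/5`) the coefficient
`2 − 5γ` is nonzero: finite-energy profiles with vanishing Bernoulli flux at infinity are trivial; at the endpoint
`ρ = 1/2` the Bernoulli flux `(|V|²/2 + P)V + (γ/2)|V|²y` is weakly divergence free.  WHAT THIS IS NOT: not NS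
regularity, not the crux; a C1 stratum tool `--supports` stmt-19832. [folklore]
-/

noncomputable section

set_option linter.dupNamespace false

open MeasureTheory Set Filter Topology Metric Function TopologicalSpace
open scoped ENNReal NNReal RealInnerProductSpace

namespace Summit.NavierStokesRegularity.NavierStokesRegularity.Theorems.PowerGaugeEulerLiouville

open Literature.Analysis Literature.Analysis.FunctionSpaces Literature.Analysis.FluidPDE

/-- **PROFILE LOCAL ENERGY EQUALITY of exactly self-similar members** (crux hypotheses verbatim + exact
self-similarity, `0 < ρ < 1`, `γ = 1/(2+ρ)`): for every test function `σ`,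
`(2 − 5γ)∫σ|V|² = ∫(|V|²+2P)⟪V,∇σ⟫ + γ∫|V|²⟪y,∇σ⟫`. [folklore] -/
theorem selfSimilar_profile_local_energy_equality {ρ : ℝ} (hρ : 0 < ρ) (hρ1 : ρ < 1)
    {u : ℝ → EuclideanSpace ℝ (Fin 3) → EuclideanSpace ℝ (Fin 3)} {p : ℝ → EuclideanSpace ℝ (Fin 3) → ℝ}
    {H : ℝ → EuclideanSpace ℝ (Fin 3) → EuclideanSpace ℝ (Fin 3) →L[ℝ] EuclideanSpace ℝ (Fin 3)} {c : ℝ≥0}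
    (hsw : IsSuitableWeakSolutionOn (slab (EuclideanSpace ℝ (Fin 3)) (Iio 0) isOpen_Iio) 0 0 u p)
    (hH : HasWeakSpatialGradientOn (slab (EuclideanSpace ℝ (Fin 3)) (Iio 0) isOpen_Iio) u H)
    (hgauge : ∀ a : ℝ, 0 < a →
      ENNReal.ofReal (a ^ (2 * ρ)) * cknA a (0 : ℝ × EuclideanSpace ℝ (Fin 3)) u +
          ENNReal.ofReal (a ^ ρ) * cknE a (0 : ℝ × EuclideanSpace ℝ (Fin 3)) H +
        ENNReal.ofReal (a ^ (2 * ρ)) * cknD a (0 : ℝ × EuclideanSpace ℝ (Fin 3)) p ≤ (c : ℝ≥0∞))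
    {V : EuclideanSpace ℝ (Fin 3) → EuclideanSpace ℝ (Fin 3)} {P : EuclideanSpace ℝ (Fin 3) → ℝ}
    (hu : ∀ τ : ℝ, τ < 0 → u τ = selfSimilarCollapse (1 / (2 + ρ)) 0 V τ)
    (hp : ∀ τ : ℝ, τ < 0 → p τ = selfSimilarCollapsePressure (1 / (2 + ρ)) 0 P τ)
    {σ : EuclideanSpace ℝ (Fin 3) → ℝ} (hσ : IsTestFunctionOn (⊤ : Opens (EuclideanSpace ℝ (Fin 3))) σ) :
    (2 - 5 * (1 / (2 + ρ))) * ∫ x, σ x * ‖V x‖ ^ 2 =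
      (∫ x, (‖V x‖ ^ 2 + 2 * P x) * ⟪V x, gradient σ x⟫) +
        (1 / (2 + ρ)) * ∫ x, ‖V x‖ ^ 2 * ⟪x, gradient σ x⟫ := by
  -- the three gauges separately
  have hA : ∀ a : ℝ, 0 < a → ENNReal.ofReal (a ^ (2 * ρ)) *
      cknA a (0 : ℝ × EuclideanSpace ℝ (Fin 3)) u ≤ (c : ℝ≥0∞) :=
    fun a ha => le_trans (le_trans le_self_add le_self_add) (hgauge a ha)
  have hE : ∀ a : ℝ, 0 < a → ENNReal.ofReal (a ^ ρ) *
      cknE a (0 : ℝ × EuclideanSpace ℝ (Fin 3)) H ≤ (c : ℝ≥0∞) :=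
    fun a ha => le_trans (le_trans le_add_self le_self_add) (hgauge a ha)
  have hD : ∀ a : ℝ, 0 < a → ENNReal.ofReal (a ^ (2 * ρ)) *
      cknD a (0 : ℝ × EuclideanSpace ℝ (Fin 3)) p ≤ (c : ℝ≥0∞) :=
    fun a ha => le_trans le_add_self (hgauge a ha)
  -- measurability of `u`, `p`, `H` on the slab (class)
  have hum : AEStronglyMeasurable (uncurry u)
      (volume.restrict (Iio (0 : ℝ) ×ˢ (univ : Set (EuclideanSpace ℝ (Fin 3))))) := by
    have := hH.locallyIntegrableOn.aestronglyMeasurable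
    simpa [slab] using this
  have hpm : AEStronglyMeasurable (uncurry p)
      (volume.restrict (Iio (0 : ℝ) ×ˢ (univ : Set (EuclideanSpace ℝ (Fin 3))))) := by
    have := hsw.distributional.2.2.1.aestronglyMeasurable
    simpa [slab] using this
  have hHm : AEStronglyMeasurable (uncurry H)
      (volume.restrict (Iio (0 : ℝ) ×ˢ (univ : Set (EuclideanSpace ℝ (Fin 3))))) := by
    have := hH.locallyIntegrableOn_grad.aestronglyMeasurable
    simpa [slab] using this
  have hVm := aestronglyMeasurable_profile hum hu
  have hPm := aestronglyMeasurable_pressureProfile hpm hp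
  -- the profile gradient and the self-similar representative of `H`
  obtain ⟨G, hGm, hVG, hHae⟩ := exists_profileGradient_ae hH hu
  set Hss : ℝ → EuclideanSpace ℝ (Fin 3) → EuclideanSpace ℝ (Fin 3) →L[ℝ] EuclideanSpace ℝ (Fin 3) :=
    fun τ x => (-τ) ^ (-1 : ℝ) • G ((-τ) ^ (-(1 / (2 + ρ))) • x) with hHss
  have hHssm' : AEStronglyMeasurable (uncurry Hss)
      (((volume : Measure ℝ).restrict (Iio (0 : ℝ))).prod (volume : Measure (EuclideanSpace ℝ (Fin 3)))) := by
    have h1 : AEStronglyMeasurable (fun z : ℝ × EuclideanSpace ℝ (Fin 3) => G ((-z.1) ^ (-(1 / (2 + ρ))) • z.2))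
        (((volume : Measure ℝ).restrict (Iio (0 : ℝ))).prod (volume : Measure (EuclideanSpace ℝ (Fin 3)))) :=
      hGm.comp_quasiMeasurePreserving (quasiMeasurePreserving_selfSimilarDilation (1 / (2 + ρ)))
    have h2 : AEStronglyMeasurable (fun z : ℝ × EuclideanSpace ℝ (Fin 3) => (-z.1) ^ (-1 : ℝ))
        (((volume : Measure ℝ).restrict (Iio (0 : ℝ))).prod (volume : Measure (EuclideanSpace ℝ (Fin 3)))) :=
      (measurable_fst.neg.pow_const _).aestronglyMeasurable
    exact h2.smul h1
  have hHm' : AEStronglyMeasurable (uncurry H)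
      (((volume : Measure ℝ).restrict (Iio (0 : ℝ))).prod (volume : Measure (EuclideanSpace ℝ (Fin 3)))) := by
    rw [Measure.volume_eq_prod, ← Measure.prod_restrict, Measure.restrict_univ] at hHm
    exact hHm
  have hprod' : uncurry H =ᵐ[((volume : Measure ℝ).restrict (Iio (0 : ℝ))).prod
      (volume : Measure (EuclideanSpace ℝ (Fin 3)))] uncurry Hss :=
    ae_eq_prod_of_ae_ae_eq hHm' hHssm' hHae
  have hprod : uncurry H =ᵐ[volume.restrict (Iio (0 : ℝ) ×ˢ (univ : Set (EuclideanSpace ℝ (Fin 3))))]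
      uncurry Hss := by
    rw [Measure.volume_eq_prod, ← Measure.prod_restrict, Measure.restrict_univ]
    exact hprod'
  have hHssm : AEStronglyMeasurable (uncurry Hss)
      (volume.restrict (Iio (0 : ℝ) ×ˢ (univ : Set (EuclideanSpace ℝ (Fin 3))))) := by
    rw [Measure.volume_eq_prod, ← Measure.prod_restrict, Measure.restrict_univ]
    exact hHssm'
  -- the `E`-gauge passes to the representative
  have hEss : ∀ a : ℝ, 0 < a → ENNReal.ofReal (a ^ ρ) *
      cknE a (0 : ℝ × EuclideanSpace ℝ (Fin 3)) Hss ≤ (c : ℝ≥0∞) := by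
    intro a ha
    have := cknE_congr_ae_slab hprod a 0
    rw [show ((0 : ℝ), (0 : EuclideanSpace ℝ (Fin 3))) = (0 : ℝ × EuclideanSpace ℝ (Fin 3)) from rfl] at this
    rw [← this]
    exact hE a ha
  -- ### the profile-side data
  have hgrowth := profile_energy_growth_of_gaugeA hρ hu hA
  have hEprof := profile_gradient_weight_of_gaugeE hρ hρ1 hHssm (fun τ _ => rfl) hEss
  have hDprof := profile_pressure_weight_of_gaugeD hρ hρ1 hpm hp hD
  -- local integrability of `V`
  have hVloc : LocallyIntegrable V volume := locallyIntegrableOn_univ.1 (by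
    simpa only [Opens.coe_top] using hVG.locallyIntegrableOn)
  have hγdef : (1 : ℝ) / (2 + ρ) = 1 / (2 + ρ) := rfl
  -- ### profile-side integrability on balls (positive radius)
  have hballR : ∀ r : ℝ, ∃ R : ℝ, 0 < R ∧ ball (0 : EuclideanSpace ℝ (Fin 3)) r ⊆ ball 0 R := fun r =>
    ⟨max r 1, lt_of_lt_of_le one_pos (le_max_right _ _), ball_subset_ball (le_max_left _ _)⟩
  -- `V ∈ L²(B_R)`
  have hV2R : ∀ R : ℝ, 0 < R → MemLp V 2 (volume.restrict (ball (0 : EuclideanSpace ℝ (Fin 3)) R)) := by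
    intro R hR
    have hlt : ∫⁻ y in ball (0 : EuclideanSpace ℝ (Fin 3)) R, ‖V y‖ₑ ^ 2 < ⊤ :=
      lt_of_le_of_lt (hgrowth R hR) (ENNReal.mul_lt_top ENNReal.coe_lt_top ENNReal.ofReal_lt_top)
    refine ⟨hVm.restrict, ?_⟩
    have h2 : ∫⁻ y in ball (0 : EuclideanSpace ℝ (Fin 3)) R, ‖V y‖ₑ ^ (2 : ℝ) =
        eLpNorm V 2 (volume.restrict (ball (0 : EuclideanSpace ℝ (Fin 3)) R)) ^ (2 : ℝ) :=
      lintegral_enorm_sq_eq_eLpNorm_sq V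
    have hlt' : eLpNorm V 2 (volume.restrict (ball (0 : EuclideanSpace ℝ (Fin 3)) R)) ^ (2 : ℝ) < ⊤ := by
      rw [← h2]
      have e : (fun y => ‖V y‖ₑ ^ (2 : ℝ)) = fun y => ‖V y‖ₑ ^ 2 := funext fun y => ENNReal.rpow_two _
      rw [e]; exact hlt
    by_contra htop
    rw [not_lt, top_le_iff] at htop
    rw [htop, ENNReal.top_rpow_of_pos (by norm_num)] at hlt'
    exact lt_irrefl _ hlt'
  -- `∫_{B_R} |G|²_F < ∞`
  have hGfrobR : ∀ R : ℝ, 0 < R →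
      ∫⁻ y in ball (0 : EuclideanSpace ℝ (Fin 3)) R, ENNReal.ofReal (frobeniusNormSq (G y)) < ⊤ := by
    intro R hR
    have hw : ∀ y ∈ ball (0 : EuclideanSpace ℝ (Fin 3)) R, y ≠ 0 →
        ENNReal.ofReal (R ^ (ρ - 1)) ≤ ENNReal.ofReal (‖y‖ ^ (ρ - 1)) := by
      intro y hy hy0
      refine ENNReal.ofReal_le_ofReal ?_
      rw [mem_ball, dist_zero_right] at hy
      exact Real.rpow_le_rpow_of_nonpos (norm_pos_iff.2 hy0) hy.le (by linarith)
    have hRpow : 0 < R ^ (ρ - 1) := Real.rpow_pos_of_pos hR _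
    have hae : ∀ᵐ y ∂(volume.restrict (ball (0 : EuclideanSpace ℝ (Fin 3)) R)),
        ENNReal.ofReal (frobeniusNormSq (G y)) * ENNReal.ofReal (R ^ (ρ - 1)) ≤
          ENNReal.ofReal (frobeniusNormSq (G y)) * ENNReal.ofReal (‖y‖ ^ (ρ - 1)) := by
      have h0 : ∀ᵐ y ∂(volume.restrict (ball (0 : EuclideanSpace ℝ (Fin 3)) R)), y ≠ (0 : EuclideanSpace ℝ (Fin 3)) := by
        have : (volume.restrict (ball (0 : EuclideanSpace ℝ (Fin 3)) R)) {0} = 0 :=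
          le_antisymm ((Measure.restrict_apply_le _ _).trans (by rw [measure_singleton])) bot_le
        exact measure_eq_zero_iff_ae_notMem.1 this
      filter_upwards [ae_restrict_mem measurableSet_ball, h0] with y hy hy0
      exact mul_le_mul_right (hw y hy hy0) _
    have h1 : (∫⁻ y in ball (0 : EuclideanSpace ℝ (Fin 3)) R, ENNReal.ofReal (frobeniusNormSq (G y))) *
        ENNReal.ofReal (R ^ (ρ - 1)) ≤ ENNReal.ofReal ((1 - ρ) / (2 + ρ)) * (c : ℝ≥0∞) := by
      rw [← lintegral_mul_const' _ _ ENNReal.ofReal_ne_top]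
      calc ∫⁻ y in ball (0 : EuclideanSpace ℝ (Fin 3)) R, ENNReal.ofReal (frobeniusNormSq (G y)) * ENNReal.ofReal (R ^ (ρ - 1))
          ≤ ∫⁻ y in ball (0 : EuclideanSpace ℝ (Fin 3)) R, ENNReal.ofReal (frobeniusNormSq (G y)) * ENNReal.ofReal (‖y‖ ^ (ρ - 1)) :=
            lintegral_mono_ae hae
        _ ≤ ∫⁻ y, ENNReal.ofReal (frobeniusNormSq (G y)) * ENNReal.ofReal (‖y‖ ^ (ρ - 1)) :=
            lintegral_mono' Measure.restrict_le_self le_rfl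
        _ ≤ _ := hEprof
    have hfin : ENNReal.ofReal ((1 - ρ) / (2 + ρ)) * (c : ℝ≥0∞) < ⊤ :=
      ENNReal.mul_lt_top ENNReal.ofReal_lt_top ENNReal.coe_lt_top
    have hne : ENNReal.ofReal (R ^ (ρ - 1)) ≠ 0 := by
      rw [ENNReal.ofReal_ne_zero_iff]; exact hRpow
    by_contra htop
    rw [not_lt, top_le_iff] at htop
    rw [htop, ENNReal.top_mul hne] at h1
    exact absurd (hfin.trans_le h1) (lt_irrefl _)
  -- `G ∈ L²(B_R)`
  have hG2R : ∀ R : ℝ, 0 < R → MemLp G 2 (volume.restrict (ball (0 : EuclideanSpace ℝ (Fin 3)) R)) := by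
    intro R hR
    refine ⟨hGm.restrict, ?_⟩
    exact lt_of_le_of_lt (eLpNorm_two_le_lintegral_frobeniusNormSq_rpow _ G)
      (ENNReal.rpow_lt_top_of_nonneg (by norm_num) (hGfrobR R hR).ne)
  -- `P ∈ L^{3/2}(B_R)`
  have hP32R : ∀ R : ℝ, 0 < R → MemLp P (3 / 2 : ℝ≥0∞) (volume.restrict (ball (0 : EuclideanSpace ℝ (Fin 3)) R)) := by
    intro R hR
    have hw : ∀ y ∈ ball (0 : EuclideanSpace ℝ (Fin 3)) R, y ≠ 0 →
        ENNReal.ofReal (R ^ (2 * ρ - 2)) ≤ ENNReal.ofReal (‖y‖ ^ (2 * ρ - 2)) := by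
      intro y hy hy0
      refine ENNReal.ofReal_le_ofReal ?_
      rw [mem_ball, dist_zero_right] at hy
      exact Real.rpow_le_rpow_of_nonpos (norm_pos_iff.2 hy0) hy.le (by linarith)
    have hRpow : 0 < R ^ (2 * ρ - 2) := Real.rpow_pos_of_pos hR _
    have hae : ∀ᵐ y ∂(volume.restrict (ball (0 : EuclideanSpace ℝ (Fin 3)) R)),
        ‖P y‖ₑ ^ (3 / 2 : ℝ) * ENNReal.ofReal (R ^ (2 * ρ - 2)) ≤
          ‖P y‖ₑ ^ (3 / 2 : ℝ) * ENNReal.ofReal (‖y‖ ^ (2 * ρ - 2)) := by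
      have h0 : ∀ᵐ y ∂(volume.restrict (ball (0 : EuclideanSpace ℝ (Fin 3)) R)), y ≠ (0 : EuclideanSpace ℝ (Fin 3)) := by
        have : (volume.restrict (ball (0 : EuclideanSpace ℝ (Fin 3)) R)) {0} = 0 :=
          le_antisymm ((Measure.restrict_apply_le _ _).trans (by rw [measure_singleton])) bot_le
        exact measure_eq_zero_iff_ae_notMem.1 this
      filter_upwards [ae_restrict_mem measurableSet_ball, h0] with y hy hy0
      exact mul_le_mul_right (hw y hy hy0) _
    have h1 : (∫⁻ y in ball (0 : EuclideanSpace ℝ (Fin 3)) R, ‖P y‖ₑ ^ (3 / 2 : ℝ)) *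
        ENNReal.ofReal (R ^ (2 * ρ - 2)) ≤ ENNReal.ofReal ((2 - 2 * ρ) / (2 + ρ)) * (c : ℝ≥0∞) := by
      rw [← lintegral_mul_const' _ _ ENNReal.ofReal_ne_top]
      calc ∫⁻ y in ball (0 : EuclideanSpace ℝ (Fin 3)) R, ‖P y‖ₑ ^ (3 / 2 : ℝ) * ENNReal.ofReal (R ^ (2 * ρ - 2))
          ≤ ∫⁻ y in ball (0 : EuclideanSpace ℝ (Fin 3)) R, ‖P y‖ₑ ^ (3 / 2 : ℝ) * ENNReal.ofReal (‖y‖ ^ (2 * ρ - 2)) :=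
            lintegral_mono_ae hae
        _ ≤ ∫⁻ y, ‖P y‖ₑ ^ (3 / 2 : ℝ) * ENNReal.ofReal (‖y‖ ^ (2 * ρ - 2)) :=
            lintegral_mono' Measure.restrict_le_self le_rfl
        _ ≤ _ := hDprof
    have hfin : ENNReal.ofReal ((2 - 2 * ρ) / (2 + ρ)) * (c : ℝ≥0∞) < ⊤ :=
      ENNReal.mul_lt_top ENNReal.ofReal_lt_top ENNReal.coe_lt_top
    have hne : ENNReal.ofReal (R ^ (2 * ρ - 2)) ≠ 0 := by
      rw [ENNReal.ofReal_ne_zero_iff]; exact hRpow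
    have hlt : ∫⁻ y in ball (0 : EuclideanSpace ℝ (Fin 3)) R, ‖P y‖ₑ ^ (3 / 2 : ℝ) < ⊤ := by
      by_contra htop
      rw [not_lt, top_le_iff] at htop
      rw [htop, ENNReal.top_mul hne] at h1
      exact absurd (hfin.trans_le h1) (lt_irrefl _)
    refine ⟨hPm.restrict, ?_⟩
    rw [eLpNorm_eq_lintegral_rpow_enorm_toReal (by
        exact (ENNReal.div_pos (by norm_num) (by norm_num)).ne') (ENNReal.div_ne_top (by norm_num) (by norm_num))]
    have hr : ((3 / 2 : ℝ≥0∞)).toReal = 3 / 2 := by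
      rw [ENNReal.toReal_div, ENNReal.toReal_ofNat, ENNReal.toReal_ofNat]
    rw [hr]
    exact ENNReal.rpow_lt_top_of_nonneg (by norm_num) hlt.ne
  -- `V ∈ L⁶(B_R)` (local Sobolev embedding)
  have hV6R : ∀ R : ℝ, 0 < R → MemLp V 6 (volume.restrict (ball (0 : EuclideanSpace ℝ (Fin 3)) R)) := by
    intro R hR
    obtain ⟨C, hC⟩ := exists_eLpNorm_six_le_ball (E := EuclideanSpace ℝ (Fin 3)) finrank_euclideanSpace_fin
      (0 : EuclideanSpace ℝ (Fin 3)) R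
    have hVGball : HasWeakFDerivOn (⟨ball (0 : EuclideanSpace ℝ (Fin 3)) R, isOpen_ball⟩ :
        Opens (EuclideanSpace ℝ (Fin 3))) volume V G := HasWeakFDerivOn.mono_set_holds hVG le_top
    have h := hC V G hVGball (hV2R R hR).eLpNorm_ne_top
    refine ⟨hVm.restrict, lt_of_le_of_lt h ?_⟩
    refine ENNReal.mul_lt_top ENNReal.coe_lt_top (ENNReal.add_lt_top.2 ⟨(hV2R R hR).eLpNorm_lt_top, ?_⟩)
    exact ENNReal.rpow_lt_top_of_nonneg (by norm_num) (hGfrobR R hR).ne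
  -- all radii
  have hV6 : ∀ r : ℝ, MemLp V 6 (volume.restrict (ball (0 : EuclideanSpace ℝ (Fin 3)) r)) := fun r => by
    obtain ⟨R, hR, hsub⟩ := hballR r
    exact (hV6R R hR).mono_measure (Measure.restrict_mono hsub le_rfl)
  have hG2 : ∀ r : ℝ, MemLp G 2 (volume.restrict (ball (0 : EuclideanSpace ℝ (Fin 3)) r)) := fun r => by
    obtain ⟨R, hR, hsub⟩ := hballR r
    exact (hG2R R hR).mono_measure (Measure.restrict_mono hsub le_rfl)
  have hP32 : ∀ r : ℝ, MemLp P (3 / 2 : ℝ≥0∞) (volume.restrict (ball (0 : EuclideanSpace ℝ (Fin 3)) r)) := fun r => by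
    obtain ⟨R, hR, hsub⟩ := hballR r
    exact (hP32R R hR).mono_measure (Measure.restrict_mono hsub le_rfl)
  -- local integrability of `|V|²` and `P`
  have hV2loc : LocallyIntegrable (fun y => ‖V y‖ ^ 2) volume := by
    refine (locallyIntegrable_iff).2 fun K hK => ?_
    obtain ⟨r, hr⟩ := hK.isBounded.subset_ball (0 : EuclideanSpace ℝ (Fin 3))
    obtain ⟨R, hR, hsub⟩ := hballR r
    have h := (hV2R R hR).integrable_norm_pow two_ne_zero
    exact IntegrableOn.mono_set (show IntegrableOn (fun y => ‖V y‖ ^ 2) (ball 0 R) volume from h) (hr.trans hsub)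
  have hPloc : LocallyIntegrable P volume := by
    refine (locallyIntegrable_iff).2 fun K hK => ?_
    obtain ⟨r, hr⟩ := hK.isBounded.subset_ball (0 : EuclideanSpace ℝ (Fin 3))
    obtain ⟨R, hR, hsub⟩ := hballR r
    haveI : IsFiniteMeasure ((volume : Measure (EuclideanSpace ℝ (Fin 3))).restrict (ball (0 : EuclideanSpace ℝ (Fin 3)) R)) :=
      isFiniteMeasure_restrict.2 measure_ball_lt_top.ne
    have h : IntegrableOn P (ball (0 : EuclideanSpace ℝ (Fin 3)) R) volume :=
      memLp_one_iff_integrable.1 ((hP32R R hR).mono_exponent (by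
        rw [ENNReal.le_div_iff_mul_le (Or.inl (by norm_num)) (Or.inl (by norm_num))]; norm_num))
    exact h.mono_set (hr.trans hsub)
  -- ### the weak profile equation and divergence-freeness (the Euler identity)
  have heq := fun (ψ : EuclideanSpace ℝ (Fin 3) → EuclideanSpace ℝ (Fin 3))
      (hψ : IsTestFunctionOn (⊤ : Opens (EuclideanSpace ℝ (Fin 3))) ψ) =>
    ProfileEquation.weak_profile_equation hsw.distributional hu hp hVloc hV2loc hPloc hψ
  have hdiv := ProfileEquation.profile_isWeaklyDivFree hsw.distributional hu hVloc
  -- ### velocity testing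
  exact ProfileEnergy.profile_local_energy_equality hVG hV6 hG2 hPm hP32 hdiv heq hσ

end Summit.NavierStokesRegularity.NavierStokesRegularity.Theorems.PowerGaugeEulerLiouville
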